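import Literature.Geometry.Lorentzian.TimelikeCurveLift
import Literature.Geometry.Lorentzian.CommonDevelopmentEmbedding
import Literature.Geometry.Lorentzian.HypersurfaceRestriction
import Literature.Geometry.Lorentzian.CauchyDevelopment

/-!
# Route SwallowTheDatum · item `SubdataDevelopmentsEmbed` (stmt-FinalStateConjecture-10053) —
# towards `hncb`, I: the image of a relative common sub-development lies in the domain of
# dependence of the sub-datum

First soft step of the reduction of the remaining hypothesis `hncb` (a maximal relative common
sub-development has no corresponding boundary points) to statements about developments of the
SAME data: for a relative common sub-development `(U, ψ)` of a Cauchy development `𝒟'` of the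
sub-data (on `N`) into a Cauchy development `𝒟` of the data (on `X`) over `Φ : N → X` — `U` open
with `ι'(N)` a Cauchy hypersurface of `(U, g'|_U)`, `ψ` smooth isometric time-orientation
preserving on `U`, injective on `U`, `ψ ∘ ι' = ι ∘ Φ` — every endless timelike curve of `M`
through a point of `ψ(U)` meets `ι(Φ N)`: its maximal piece inside the open set `ψ(U)` lifts
along the injective local isometry `ψ|_U` (`LorentzianMetric.exists_lift_isEndlessTimelikeCurve`,
Sbierski 2016, §3.3: "`γ|_J` can be considered as an inextendible timelike curve in `U`") to an
endless timelike curve of `U`, which meets the Cauchy hypersurface `ι'(N)` of `U`, and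
`ψ(ι' v) = ι(Φ v)`. Hence `ψ(U)` lies in the domain of dependence of `ι(Φ N)` — with the
universality clause of `exists_opens_isCauchyHypersurface_of_localDoD` (`…DoDAssembly.lean`), in
the globally hyperbolic region `V` of `hcauchy`.

No definition, no named fact.
-/

noncomputable section

open Function Set Filter Topology TopologicalSpace Bundle Manifold
open scoped Manifold ContDiff Topology

namespace Summit.FinalStateConjecture.FinalStateConjecture.Theorems

namespace SubdataDevelopmentsEmbed

open Literature.Geometry.Lorentzian

universe u

variable {n : ℕ}
  {N : Type u} [TopologicalSpace N] [ChartedSpace (EuclideanSpace ℝ (Fin n)) N]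
  [IsManifold (𝓡 n) ∞ N] [ConnectedSpace N] {D₁ : InitialDataSet (𝓡 n) N}
  {X : Type u} [TopologicalSpace X] [ChartedSpace (EuclideanSpace ℝ (Fin n)) X]
  [IsManifold (𝓡 n) ∞ X] [ConnectedSpace X] {D₂ : InitialDataSet (𝓡 n) X}

/-- **The image of a relative common sub-development lies in the domain of dependence of the
sub-datum.** For a relative common sub-development `(U, ψ)` of `𝒟'` (data on `N`) into `𝒟`
(data on `X`) over `Φ` — `ι'(N)` a Cauchy hypersurface of the open sub-spacetime `U`, `ψ` smooth,
isometric and time-orientation preserving on `U`, injective on `U`, `ψ ∘ ι' = ι ∘ Φ` — every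
endless timelike curve of `M` through a point of `ψ(U)` meets `ι(Φ N)` (Sbierski 2016, §3.3,
lifting step; Choquet-Bruhat–Geroch 1969, p. 331). -/
theorem forall_endless_meets_of_relCGHD (𝒟' : CauchyDevelopment D₁) (𝒟 : CauchyDevelopment D₂)
    {Φ : N → X} (U : Opens 𝒟'.carrier) (ψ : 𝒟'.carrier → 𝒟.carrier)
    (hC : (𝒟'.metric.restrict PseudoRiemannianMetric.contMDiff_restrict_holds
        U).IsCauchyHypersurface
      (𝒟'.timeOrientation.restrict PseudoRiemannianMetric.contMDiff_restrict_holds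
        𝒟'.timeOrientation.contMDiff_restrict_holds U) (Subtype.val ⁻¹' range 𝒟'.embed))
    (hs : ContMDiffOn (𝓡 (n + 1)) (𝓡 (n + 1)) ∞ ψ U)
    (hi : ∀ p ∈ U, pullbackBilin (I := 𝓡 (n + 1)) (I' := 𝓡 (n + 1)) ψ 𝒟.metric.val p =
      𝒟'.metric.val p)
    (ht : ∀ p ∈ U, 𝒟.timeOrientation.IsFutureDirected
      (mfderiv (𝓡 (n + 1)) (𝓡 (n + 1)) ψ p (𝒟'.timeOrientation.vectorField p)))
    (hc : ψ ∘ 𝒟'.embed = 𝒟.embed ∘ Φ) (hinj : InjOn ψ U) :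
    ∀ y ∈ ψ '' (U : Set 𝒟'.carrier), ∀ (γ : ℝ → 𝒟.carrier) (u : Set ℝ),
      𝒟.metric.IsEndlessTimelikeCurve 𝒟.timeOrientation γ u → ∀ t ∈ u, γ t = y →
        ∃ t' ∈ u, γ t' ∈ range (𝒟.embed ∘ Φ) := by
  rintro y ⟨x₀, hx₀, rfl⟩ γ u hγ t₀ ht₀ hγt₀
  set F : U → 𝒟.carrier := ψ ∘ Subtype.val with hF
  have hd : ∀ y : U, MDifferentiableAt (𝓡 (n + 1)) (𝓡 (n + 1)) ψ y.1 := fun y ↦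
    ((hs y.1 y.2).contMDiffAt (U.2.mem_nhds y.2)).mdifferentiableAt (by simp)
  -- `ψ|_U` is an injective local isometry preserving the time orientations
  have hiso : (𝒟'.metric.restrict PseudoRiemannianMetric.contMDiff_restrict_holds
      U).IsIsometricImmersion 𝒟.metric.toPseudoRiemannianMetric F := by
    refine ⟨hs.comp_contMDiff contMDiff_subtype_val fun y ↦ y.2, fun y ↦ ?_⟩
    ext v w
    rw [pullbackBilin_apply, hF, mfderiv_comp_subtypeVal (hd y)]
    have h := congrArg (fun b ↦ b v w) (hi y.1 y.2)
    simp only [pullbackBilin_apply] at h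
    exact h
  have htop : (𝒟'.timeOrientation.restrict PseudoRiemannianMetric.contMDiff_restrict_holds
      𝒟'.timeOrientation.contMDiff_restrict_holds U).PreservesTimeOrientation F
      𝒟.timeOrientation := by
    intro y
    rw [hF, mfderiv_comp_subtypeVal (hd y)]
    exact ht y.1 y.2
  have hinjF : Injective F := fun a b h ↦ Subtype.ext (hinj a.2 b.2 h)
  have hloc := LorentzianMetric.isLocalDiffeomorph_of_isIsometricImmersion hiso
  -- lift the maximal piece of `γ` inside `ψ(U)` to an endless timelike curve of `U`
  have hγt : γ t₀ ∈ range F := ⟨⟨x₀, hx₀⟩, by rw [hγt₀]; rfl⟩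
  obtain ⟨δ, hδ, hδc⟩ := LorentzianMetric.exists_lift_isEndlessTimelikeCurve
    (𝒟'.timeOrientation.restrict PseudoRiemannianMetric.contMDiff_restrict_holds
      𝒟'.timeOrientation.contMDiff_restrict_holds U)
    𝒟.timeOrientation hiso htop hinjF hloc hγ ht₀ hγt
  -- it meets the Cauchy hypersurface `ι'(N)` of `U`, and `ψ(ι' v) = ι(Φ v)`
  obtain ⟨t, ⟨htc, v, hv⟩, -⟩ := hC δ _ hδc
  refine ⟨t, (connectedComponentIn_subset _ _ htc).1, v, ?_⟩
  have h1 : γ t = ψ (𝒟'.embed v) := by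
    rw [← hδ t htc, hF, comp_apply, hv]
  rw [h1]
  exact (congrFun hc v).symm

end SubdataDevelopmentsEmbed

end Summit.FinalStateConjecture.FinalStateConjecture.Theorems

end
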